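import Mathlib
import HarnessLib
import Literature.Probability.LatticeModels.SRWKilledWalkFunctionals
import Literature.Probability.RandomPlanarGeometry.ConformalRectangle
import Summits.CriticalPhenomena.SAWScalingLimit.Theses.SAWExcursionCardy
import Literature.Probability.LatticeModels.GreenBoundaryFactorisation

/-!
# Route SAWExcursionCardy — `RWGreenCrossRatioLimit` from the Kozdron–Lawler boundary factorisation

Item `stmt-CriticalPhenomena-4515` (`RWGreenCrossRatioLimit`, support): for a conformal rectangle
`R = (Ω; a, c, d, b)` (marked points `pt 0 = a`, `pt 1 = c`, `pt 2 = d`, `pt 3 = b`), lattice endpoints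
`a_δ, b_δ` of the SAW (`SAW.IsEndpointApprox (R.chord 0 3) a b`), boundary vertices `c_δ, d_δ` of `Ω_δ`
with `δ c_δ → c`, `δ d_δ → d`, and every uniformizing datum `(φ, x)` of `R`, the random-walk cross-ratio
`√Λ_δ`, `Λ_δ = G(a_δ,d_δ) G(c_δ,b_δ) / (G(a_δ,c_δ) G(d_δ,b_δ))`, tends to Cardy's cross-ratio
`crossRatio x`; here `G = SRW.killedGreen (discreteDomainGraph Ω δ)` is the Green function of simple
random walk run along the edges of `Ω_δ` and killed at its first non-`Ω_δ` step (the route's inlined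
`let Gf` is literally `SRW.killedGreen`, `SRW.killedGreen_def`).

## Contents

* `KozdronLawler2005_greenBoundaryFactorisationLimit` — NAMED FACT (the discrete-potential-theory
  input, not proved in the tree): the two-point boundary factorisation of the killed Green function,
  `G(p_δ,q_δ) / (G(o_δ,p_δ) G(o_δ,q_δ)) → (π/4)(1+s²)(1+t²)/(s−t)²` when `δp_δ → u`, `δq_δ → v` are two
  boundary points with real preimages `s ≠ t` under a uniformizing map `ψ : ℍ → Ω` and `δo_δ → ψ(i)`
  (Kozdron–Lawler 2005, Prop. 3.10 / Thm. 1.1, read in the scaling limit along `Ω_δ → Ω`).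
* `tendsto_sqrt_greenCrossRatio` — the cross-ratio limit in `SRW.killedGreen` vocabulary, from the fact:
  in the 4-ratio every marked point occurs once upstairs and once downstairs, so the base-point
  normalisers `G(o_δ,·)` cancel, the four limits multiply to `(crossRatio x)²`, and `√·` is continuous.
* `RWGreenCrossRatioLimit_of_greenBoundaryFactorisation` — the route decl, CONDITIONAL on the fact.

## What is deliberately not here

The proof of the named fact (KMT strong approximation, Beurling estimates and the boundary Harnack-type
Lemma 3.11 of Kozdron–Lawler; Carathéodory convergence of the lattice domains), which is the whole
analytic content of the item; see the docstring of the fact for the exact provenance and the adaptation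
of conventions.
-/

namespace Summit.CriticalPhenomena.SAWScalingLimit.Theorems

open Filter Topology
open Literature.Probability.LatticeModels Literature.Probability.RandomPlanarGeometry
open UpperHalfPlane (upperHalfPlaneSet)

/-- The mesh point of the nearest site to `z` converges to `z` as the mesh `δ → 0⁺`
(`dist ≤ δ`, `dist_meshPoint_nearestSite_le`). [folklore] -/
theorem tendsto_meshPoint_nearestSite (z : ℂ) :
    Tendsto (fun δ : ℝ => meshPoint δ (nearestSite δ z)) (𝓝[>] 0) (𝓝 z) := by
  rw [tendsto_iff_dist_tendsto_zero]
  refine squeeze_zero' (Eventually.of_forall fun δ => dist_nonneg) ?_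
    (tendsto_id.mono_left nhdsWithin_le_nhds)
  filter_upwards [self_mem_nhdsWithin] with δ hδ
  exact dist_meshPoint_nearestSite_le hδ z

/-- Two sites joined by a walk of `Ω_δ` and distinct both lie in the discrete domain `meshDomain Ω δ`
(the first edge of the walk, resp. of its reverse, is an edge of `Ω_δ`). [folklore] -/
theorem mem_meshDomain_of_reachable_of_ne {Ω : Set ℂ} {δ : ℝ} {p q : Site 2}
    (h : (discreteDomainGraph Ω δ).Reachable p q) (hne : p ≠ q) :
    p ∈ meshDomain Ω δ ∧ q ∈ meshDomain Ω δ := by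
  have key : ∀ {p q : Site 2}, (discreteDomainGraph Ω δ).Reachable p q → p ≠ q →
      p ∈ meshDomain Ω δ := by
    rintro p q ⟨w⟩ hne
    cases w with
    | nil => exact (hne rfl).elim
    | cons hadj _ => exact (discreteDomainGraph_adj_iff.1 hadj).2.1
  exact ⟨key h hne, key h.symm hne.symm⟩

/-- Two lattice families whose mesh points converge to distinct points are eventually distinct.
[folklore] -/
theorem eventually_ne_of_tendsto_meshPoint {l : Filter ℝ} {p q : ℝ → Site 2} {u v : ℂ}
    (hp : Tendsto (fun δ => meshPoint δ (p δ)) l (𝓝 u))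
    (hq : Tendsto (fun δ => meshPoint δ (q δ)) l (𝓝 v)) (huv : u ≠ v) :
    ∀ᶠ δ in l, p δ ≠ q δ := by
  have hε : 0 < dist u v / 2 := div_pos (dist_pos.2 huv) two_pos
  filter_upwards [Metric.tendsto_nhds.1 hp _ hε, Metric.tendsto_nhds.1 hq _ hε] with δ h1 h2 heq
  rw [heq] at h1
  have := dist_triangle_left u v (meshPoint δ (q δ))
  linarith

/-- **The random-walk cross-ratio tends to Cardy's cross-ratio** (in `SRW.killedGreen` vocabulary),
conditionally on the Kozdron–Lawler boundary factorisation
`KozdronLawler2005_greenBoundaryFactorisationLimit`: with `G = SRW.killedGreen (discreteDomainGraph Ω δ)`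
and `R = (Ω; a, c, d, b)`, `√(G(a_δ,d_δ) G(c_δ,b_δ) / (G(a_δ,c_δ) G(d_δ,b_δ))) → crossRatio x` for
every uniformizing datum `(φ, x)`. Proof: apply the factorisation to the four pairs `(a,d), (c,b),
(a,c), (d,b)` with base point `o_δ = nearestSite δ (φ i)`; the normalisers `G(o_δ,·)` cancel in the
4-ratio (each marked point occurs once up and once down), the constants `π/4` and the factors
`1 + xᵢ²` cancel likewise, leaving `((x₀−x₁)(x₂−x₃))² / ((x₀−x₂)(x₁−x₃))² = (crossRatio x)²`, and
`crossRatio x > 0` (`crossRatio_mem_Ioo`). [folklore] -/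
theorem tendsto_sqrt_greenCrossRatio (hKL : Literature.Probability.LatticeModels.KozdronLawler2005_greenBoundaryFactorisationLimit)
    (R : ConformalRectangle) (a b c d : ℝ → Site 2)
    (hab : SAW.IsEndpointApprox (R.chord 0 3 (by decide)) a b)
    (hc : Tendsto (fun δ => meshPoint δ (c δ)) (𝓝[>] 0) (𝓝 (R.pt 1)))
    (hd : Tendsto (fun δ => meshPoint δ (d δ)) (𝓝[>] 0) (𝓝 (R.pt 2)))
    (hbd : ∀ᶠ δ in 𝓝[>] 0, c δ ∈ meshBoundary R.carrier δ ∧ d δ ∈ meshBoundary R.carrier δ)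
    (φ : ConformalEquiv upperHalfPlaneSet R.carrier) (x : Fin 4 → ℝ) (hφ : R.IsUniformizing φ x) :
    Tendsto (fun δ => Real.sqrt
      (SRW.killedGreen (discreteDomainGraph R.carrier δ) (a δ) (d δ) *
        SRW.killedGreen (discreteDomainGraph R.carrier δ) (c δ) (b δ) /
        (SRW.killedGreen (discreteDomainGraph R.carrier δ) (a δ) (c δ) *
          SRW.killedGreen (discreteDomainGraph R.carrier δ) (d δ) (b δ))))
      (𝓝[>] 0) (𝓝 (crossRatio x)) := by
  have hx : Function.Injective x := hφ.injective
  have h01 : x 0 ≠ x 1 := hx.ne (by decide)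
  have h02 : x 0 ≠ x 2 := hx.ne (by decide)
  have h13 : x 1 ≠ x 3 := hx.ne (by decide)
  have h23 : x 2 ≠ x 3 := hx.ne (by decide)
  -- the base point `o_δ → φ i`
  set o : ℝ → Site 2 := fun δ => nearestSite δ (φ Complex.I) with ho_def
  have ho : Tendsto (fun δ => meshPoint δ (o δ)) (𝓝[>] 0) (𝓝 (φ Complex.I)) :=
    tendsto_meshPoint_nearestSite _
  -- the marked points as limits of the lattice families
  have ha : Tendsto (fun δ => meshPoint δ (a δ)) (𝓝[>] 0) (𝓝 (R.pt 0)) := hab.tendsto_fst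
  have hb : Tendsto (fun δ => meshPoint δ (b δ)) (𝓝[>] 0) (𝓝 (R.pt 3)) := hab.tendsto_snd
  -- all four families eventually lie in the discrete domain
  have h03 : R.pt 0 ≠ R.pt 3 := fun h => absurd (R.pt_injective h) (by decide)
  have hmem_ab : ∀ᶠ δ in 𝓝[>] 0, a δ ∈ meshDomain R.carrier δ ∧ b δ ∈ meshDomain R.carrier δ := by
    filter_upwards [hab.reachable, eventually_ne_of_tendsto_meshPoint ha hb h03] with δ hr hne
    exact mem_meshDomain_of_reachable_of_ne hr hne
  have hmem_cd : ∀ᶠ δ in 𝓝[>] 0, c δ ∈ meshDomain R.carrier δ ∧ d δ ∈ meshDomain R.carrier δ := by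
    filter_upwards [hbd] with δ h
    exact ⟨meshBoundary_subset_meshDomain _ _ h.1, meshBoundary_subset_meshDomain _ _ h.2⟩
  -- the four instances of the factorisation
  have T02 := hKL R.toJordanDomain φ (x 0) (x 2) (R.pt 0) (R.pt 2) h02 (hφ.2 0) (hφ.2 2) a d o ha hd ho
    (by filter_upwards [hmem_ab, hmem_cd] with δ h h'; exact ⟨h.1, h'.2⟩)
  have T13 := hKL R.toJordanDomain φ (x 1) (x 3) (R.pt 1) (R.pt 3) h13 (hφ.2 1) (hφ.2 3) c b o hc hb ho
    (by filter_upwards [hmem_ab, hmem_cd] with δ h h'; exact ⟨h'.1, h.2⟩)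
  have T01 := hKL R.toJordanDomain φ (x 0) (x 1) (R.pt 0) (R.pt 1) h01 (hφ.2 0) (hφ.2 1) a c o ha hc ho
    (by filter_upwards [hmem_ab, hmem_cd] with δ h h'; exact ⟨h.1, h'.1⟩)
  have T23 := hKL R.toJordanDomain φ (x 2) (x 3) (R.pt 2) (R.pt 3) h23 (hφ.2 2) (hφ.2 3) d b o hd hb ho
    (by filter_upwards [hmem_ab, hmem_cd] with δ h h'; exact ⟨h'.2, h.2⟩)
  -- the limits of the denominators are nonzero
  have hL : ∀ s t : ℝ, s ≠ t → Real.pi / 4 * ((1 + s ^ 2) * (1 + t ^ 2)) / (s - t) ^ 2 ≠ 0 := by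
    intro s t hst
    have : (s - t) ^ 2 ≠ 0 := pow_ne_zero 2 (sub_ne_zero.2 hst)
    positivity
  have hne01 := T01.eventually_ne (hL _ _ h01)
  have hne23 := T23.eventually_ne (hL _ _ h23)
  -- the 4-ratio is the ratio of the normalised 2-point functions (normalisers cancel)
  have heq : ∀ᶠ δ in 𝓝[>] 0,
      Real.sqrt (SRW.killedGreen (discreteDomainGraph R.carrier δ) (a δ) (d δ) /
            (SRW.killedGreen (discreteDomainGraph R.carrier δ) (o δ) (a δ) * SRW.killedGreen (discreteDomainGraph R.carrier δ) (o δ) (d δ)) *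
          (SRW.killedGreen (discreteDomainGraph R.carrier δ) (c δ) (b δ) /
            (SRW.killedGreen (discreteDomainGraph R.carrier δ) (o δ) (c δ) * SRW.killedGreen (discreteDomainGraph R.carrier δ) (o δ) (b δ))) /
          (SRW.killedGreen (discreteDomainGraph R.carrier δ) (a δ) (c δ) /
              (SRW.killedGreen (discreteDomainGraph R.carrier δ) (o δ) (a δ) * SRW.killedGreen (discreteDomainGraph R.carrier δ) (o δ) (c δ)) *
            (SRW.killedGreen (discreteDomainGraph R.carrier δ) (d δ) (b δ) /
              (SRW.killedGreen (discreteDomainGraph R.carrier δ) (o δ) (d δ) * SRW.killedGreen (discreteDomainGraph R.carrier δ) (o δ) (b δ))))) =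
        Real.sqrt (SRW.killedGreen (discreteDomainGraph R.carrier δ) (a δ) (d δ) * SRW.killedGreen (discreteDomainGraph R.carrier δ) (c δ) (b δ) /
          (SRW.killedGreen (discreteDomainGraph R.carrier δ) (a δ) (c δ) * SRW.killedGreen (discreteDomainGraph R.carrier δ) (d δ) (b δ))) := by
    filter_upwards [hne01, hne23] with δ h1 h2
    obtain ⟨hC, hαγ⟩ := div_ne_zero_iff.1 h1
    obtain ⟨hE, hηβ⟩ := div_ne_zero_iff.1 h2
    obtain ⟨hα, hγ⟩ := mul_ne_zero_iff.1 hαγ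
    obtain ⟨hη, hβ⟩ := mul_ne_zero_iff.1 hηβ
    congr 1
    field_simp
  -- the limit of the ratio of normalised 2-point functions is `(crossRatio x)²`
  have hlim : Real.pi / 4 * ((1 + x 0 ^ 2) * (1 + x 2 ^ 2)) / (x 0 - x 2) ^ 2 *
        (Real.pi / 4 * ((1 + x 1 ^ 2) * (1 + x 3 ^ 2)) / (x 1 - x 3) ^ 2) /
        (Real.pi / 4 * ((1 + x 0 ^ 2) * (1 + x 1 ^ 2)) / (x 0 - x 1) ^ 2 *
          (Real.pi / 4 * ((1 + x 2 ^ 2) * (1 + x 3 ^ 2)) / (x 2 - x 3) ^ 2)) =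
      crossRatio x ^ 2 := by
    have e01 : x 0 - x 1 ≠ 0 := sub_ne_zero.2 h01
    have e02 : x 0 - x 2 ≠ 0 := sub_ne_zero.2 h02
    have e13 : x 1 - x 3 ≠ 0 := sub_ne_zero.2 h13
    have e23 : x 2 - x 3 ≠ 0 := sub_ne_zero.2 h23
    have p0 : (1 + x 0 ^ 2) ≠ 0 := by positivity
    have p1 : (1 + x 1 ^ 2) ≠ 0 := by positivity
    have p2 : (1 + x 2 ^ 2) ≠ 0 := by positivity
    have p3 : (1 + x 3 ^ 2) ≠ 0 := by positivity
    have hpi : Real.pi ≠ 0 := Real.pi_ne_zero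
    unfold crossRatio
    field_simp
  have hcr : 0 < crossRatio x := (ConformalRectangle.crossRatio_mem_Ioo_of_isUniformizing hφ).1
  have hmain := ((T02.mul T13).div (T01.mul T23)
    (mul_ne_zero (hL _ _ h01) (hL _ _ h23))).sqrt
  rw [hlim, Real.sqrt_sq hcr.le] at hmain
  exact hmain.congr' heq

/-- **Item `stmt-CriticalPhenomena-4515` (`RWGreenCrossRatioLimit`), conditional form.** The route
decl `RWGreenCrossRatioLimit` of route `SAWExcursionCardy` — the random-walk cross-ratio
`√(G(a_δ,d_δ)G(c_δ,b_δ)/(G(a_δ,c_δ)G(d_δ,b_δ)))` of the killed-walk Green functions of `Ω_δ` tends to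
`crossRatio x` for every uniformizing datum — holds conditionally on the Kozdron–Lawler boundary
factorisation `KozdronLawler2005_greenBoundaryFactorisationLimit` (named fact, the item's only
analytic input; mechanism of the route text: "local parts cancel in the 4-ratio"). The route's inlined
`let Gf` is `SRW.killedGreen` by `SRW.killedGreen_def` (definitional), so this is
`tendsto_sqrt_greenCrossRatio` verbatim. [folklore] -/
theorem RWGreenCrossRatioLimit_of_greenBoundaryFactorisation
    (hKL : Literature.Probability.LatticeModels.KozdronLawler2005_greenBoundaryFactorisationLimit) :
    Summit.CriticalPhenomena.SAWScalingLimit.Theses.SAWExcursionCardy.RWGreenCrossRatioLimit := by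
  intro R a b c d hab hc hd hbd
  exact tendsto_sqrt_greenCrossRatio hKL R a b c d hab hc hd hbd

end Summit.CriticalPhenomena.SAWScalingLimit.Theorems
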